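import Literature.IUT.LogThetaLattice.PacketLogVolumes
import Literature.IUT.LogThetaLattice.PacketLogVolumesHaarModelDegree
import Literature.IUT.LogThetaLattice.PacketLogVolumesHaarModelRelLocalArch
import HarnessLib

/-!
# [IUTchIII] Remark 3.9.2 AT THE GENUINE HAAR MODELS: the «nonnegative elements» recovered from the effect of
# multiplication on log-volumes — absolute (`K = F_mod = F`) and VERBATIM AT `𝕍̲` (relative `K ⊋ F_mod`)

S. Mochizuki, *Inter-universal Teichmüller theory III*, kurims manuscript (May 2020), Remark 3.9.2, p. 119
(lit key `paper:url-4b091feeb646`) [claim: Mochizuki2012, status: disputed]: "one may construct ['mono-analytic']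
algorithms for recovering the subquotient of the perfection of `(†𝕄⊛_mod)_α = (†𝕄⊛_MOD)_α` associated to `w ∈ 𝕍̲`
[cf. Remark 3.6.1], together with the submonoid of 'nonnegative elements' of such a subquotient, by considering
the effect of multiplication by elements of `(†𝕄⊛_mod)_α` on the log-volumes defined on the various
`𝓘^ℚ(^{A,α}𝓕_v) ≅ 𝓘^ℚ(^{A,α}𝒟^⊢_v)` [cf. [AbsTopIII], Proposition 5.8, (iv), (vi)]."

abc-iut-L6-t4 typed the recovered set as `Remark392_nonnegAt act vol := {f | ∀ S, vol (act f S) ≤ vol S}`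
(`PacketLogVolumes.lean`, p404053); abc-iut-w5-d178 (gen 0) computed it for an ABSTRACT nonarchimedean local field
resp. `ℂ` with abc-iut-L4-t3's volumes (`remark392_nonnegAt_localField` p415945, `remark392_nonnegAt_arch` p416218).
THIS FILE (row «RMK392-GENUINE» of plan/L6/DISCHARGE-L6, split off by abc-iut-w5-d004 g4 2026-08-26T05:45:57Z,
first refusal exercised by the abc-iut-w5-d178 lineage) computes it AT THE GENUINE MODELS of [IUTchIII] Prop. 3.9
— abc-iut-L6-d3's place data `placeDatum F v` (`PacketLogVolumesHaarModel.lean` p415871: completions `F_v` with the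
Haar volume of [AbsTopIII] Prop. 5.7 (i), `ℂ` with the radial volume of Prop. 5.7 (ii), `f ∈ F` acting by
multiplication, modulus `‖f‖_v`) and abc-iut-L6-t5's RELATIVE summands `relPlaceDatum F K w` (`…RelLocal.lean`
p421193: the summand `K_w` of the packet of `K ⊋ F_mod`, on which `f ∈ F_mod = F` acts through `F ↪ K ↪ K_w`):

* (1) GENERIC (`PlaceHaarDatum.remark392_nonnegAt_units_eq`): over ANY place datum `D` of abc-iut-L6-d3 (one law
  `μ(f·T) = ‖f‖·μ(T)`) admitting at least one region of positive finite volume, the set recovered from the action of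
  `F^×` and the log-volume `μ^log = log μ` on ALL subsets is exactly `{f ∈ F^× | ‖f‖ ≤ 1}`: if `‖f‖ ≤ 1` no
  log-volume increases (zero/infinite volumes carry `Real.log`'s junk value `0` on both sides and do not disturb the
  comparison); if `‖f‖ > 1` the admissible region detects it (`μ^log(f·T) = μ^log(T) + log‖f‖ > μ^log(T)`,
  d3's `logVol_actAdm`). If moreover `‖·‖` is multiplicative, the recovered set is a SUBMONOID
  (`remark392_nonnegAt_units_one_mem/_mul_mem`) whose group of invertible elements is `{‖f‖ = 1}`
  (`mem_and_inv_mem_remark392_nonnegAt_iff`) — the "subquotient … together with the submonoid of nonnegative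
  elements" of the printed sentence. For an arbitrary monoid action the recovered set is closed under `1` and `*`
  with NO hypothesis on volumes (`one_mem_remark392_nonnegAt`, `mul_mem_remark392_nonnegAt`).
* (2) ABSOLUTE GENUINE MODEL (`remark392_nonnegAt_placeDatum_inr/_inl`): at a finite place `v` of `F` the recovered
  set is **`{f ∈ F^× | 0 ≤ ord_v(f)}`** — print's «nonnegative elements» (campaign-S `ord`, `ArakelovDivisors.lean`),
  via `log‖f‖_v = −ord_v(f)·log q_v` (campaign-S `log_adicAbv_eq_neg_deg`); at an archimedean place `w` it is
  `{f | |f|_w ≤ 1}`.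
* (3) VERBATIM AT `𝕍̲` (`remark392_nonnegAt_relPlaceDatum_eq_below`, `…_relPlaceDatum_inr/_inl`): for EVERY place
  `w` of `K`, the action of `F_mod^×` on the summand `K_w` recovers the SAME set as the absolute model of `F_mod` at
  the place `v = w|_{F_mod}` below — at finite `w` because `log‖f‖_{K_w} = [K_w:F_v]·log‖f‖_v` with `[K_w:F_v] > 0`
  (abc-iut-L6-t5 `log_modulus_relPlaceDatum_inr`), at archimedean `w` because `|f|_w = |f|_v` (abc-iut-w5-d030
  `modulus_relPlaceDatum_inl`); i.e. the subquotient of `(†𝕄⊛_mod)_α` "associated to `w ∈ 𝕍̲`" with its nonnegative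
  submonoid `{0 ≤ ord_v}` is recovered from the `w`-summand, as printed.
* (4) the submonoid / kernel clauses at the genuine and relative data (`…_placeDatum_mul_mem`, `…_relPlaceDatum_mul_mem`,
  `…_placeDatum_inr_units_iff` : `f, f⁻¹` both recovered `⟺ ord_v(f) = 0`).

Proof-only file (theorems only; no `def`, no new interface); every input consumed BY NAME; nothing of
abc-iut-L6-t4 / L6-d3 / L6-t5 / w5-d030 is restated or edited. Classical mathematics (absolute values, Haar
moduli); nothing here constructs `(†𝓕⊛_mod)_α`, bears on the disputed [IUTchIII] Cor. 3.12, or takes a side;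
typed ≠ endorsed. [cite: MochizukiAbsTopIII2015, Prop. 5.7 (i)(b) p. 138]
-/

noncomputable section

namespace Literature.IUT.LogThetaLattice

open Literature.IUT.LogVolume NumberField IsDedekindDomain
open scoped ENNReal NNReal

/-! ### (4), abstract part: the recovered set is closed under `1` and `*` for any monoid action -/

section Monoid

variable {M X : Type*} [Monoid M] (act : M → Set X → Set X) (vol : Set X → ℝ)

/-- For any action with `1·S = S`, the unit is recovered as «nonnegative» ([IUTchIII] Rmk 3.9.2: the recovered set
is a submonoid). [claim: Mochizuki2012, status: disputed] -/
theorem one_mem_remark392_nonnegAt (h1 : ∀ S : Set X, act 1 S = S) : (1 : M) ∈ Remark392_nonnegAt act vol := by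
  simp only [Remark392_nonnegAt, Set.mem_setOf_eq]
  intro S
  rw [h1]

/-- For any action with `(fg)·S = f·(g·S)`, the recovered set of «nonnegative elements» is closed under
multiplication (`vol((fg)·S) = vol(f·(g·S)) ≤ vol(g·S) ≤ vol(S)`) — no hypothesis on the volume at all.
[claim: Mochizuki2012, status: disputed] -/
theorem mul_mem_remark392_nonnegAt (hmul : ∀ (f g : M) (S : Set X), act (f * g) S = act f (act g S)) {f g : M}
    (hf : f ∈ Remark392_nonnegAt act vol) (hg : g ∈ Remark392_nonnegAt act vol) :
    f * g ∈ Remark392_nonnegAt act vol := by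
  simp only [Remark392_nonnegAt, Set.mem_setOf_eq] at hf hg ⊢
  intro S
  rw [hmul]
  exact (hf _).trans (hg S)

end Monoid

/-! ### (1) Generic over a place datum of abc-iut-L6-d3: the recovered set is `{‖f‖ ≤ 1}` -/

namespace PlaceHaarDatum

variable {F : Type} [Field F] (D : PlaceHaarDatum F)

/-- `μ^log(f·S) = log(‖f‖·μ(S))` on EVERY subset (d3's law `μ(f·T) = ‖f‖·μ(T)`; `Real.log`'s junk value `0` when
`μ(S) ∈ {0, ∞}`). [claim: Mochizuki2012, status: disputed] -/
theorem logVol_act {f : F} (hf : f ≠ 0) (S : Set D.X) :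
    D.logVol (D.act f S) = Real.log (D.modulus f * (D.vol S).toReal) := by
  rw [logVol, D.vol_act hf, ENNReal.toReal_mul, ENNReal.toReal_ofReal (D.modulus_pos hf).le]

/-- If `‖f‖ ≤ 1`, multiplication by `f` never increases a log-volume — on every subset.
[claim: Mochizuki2012, status: disputed] -/
theorem logVol_act_le {f : F} (hf : f ≠ 0) (hm : D.modulus f ≤ 1) (S : Set D.X) :
    D.logVol (D.act f S) ≤ D.logVol S := by
  rw [D.logVol_act hf S, logVol]
  by_cases hS : (D.vol S).toReal = 0
  · rw [hS, mul_zero]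
  · have hm0 := D.modulus_pos hf
    rw [Real.log_mul hm0.ne' hS]
    have : Real.log (D.modulus f) ≤ 0 := Real.log_nonpos hm0.le hm
    linarith

/-- If `‖f‖ > 1`, multiplication by `f` STRICTLY increases the log-volume of every admissible region
(`μ^log(f·T) = μ^log(T) + log‖f‖`, d3's `logVol_actAdm`). [claim: Mochizuki2012, status: disputed] -/
theorem logVol_lt_logVol_act {f : F} (hf : f ≠ 0) (hm : 1 < D.modulus f) (T : D.Adm) :
    D.logVol T.1 < D.logVol (D.act f T.1) := by
  have h := D.logVol_actAdm (Units.mk0 f hf) T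
  rw [actAdm_val, Units.val_mk0] at h
  rw [h]
  have : 0 < Real.log (D.modulus f) := Real.log_pos hm
  linarith

/-- **[IUTchIII] Remark 3.9.2 over a place datum (generic form).** If the summand carries at least one region of
positive finite volume, then the set of `f ∈ F^×` whose multiplication action increases NO log-volume
(abc-iut-L6-t4's `Remark392_nonnegAt`, quantified over ALL subsets) is exactly `{f | ‖f‖ ≤ 1}`.
[claim: Mochizuki2012, status: disputed] -/
theorem remark392_nonnegAt_units_eq (hT : Nonempty D.Adm) :
    Remark392_nonnegAt (fun (f : Fˣ) (S : Set D.X) => D.act (f : F) S) D.logVol =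
      {f : Fˣ | D.modulus (f : F) ≤ 1} := by
  obtain ⟨T⟩ := hT
  ext f
  simp only [Remark392_nonnegAt, Set.mem_setOf_eq]
  constructor
  · intro h
    by_contra hlt
    exact absurd (h T.1) (not_le.mpr (D.logVol_lt_logVol_act f.ne_zero (not_le.mp hlt) T))
  · intro hf S
    exact D.logVol_act_le f.ne_zero hf S

/-- With a multiplicative modulus, `‖1‖ = 1`. [claim: Mochizuki2012, status: disputed] -/
theorem modulus_one_of_mul (hmod : ∀ f g : F, D.modulus (f * g) = D.modulus f * D.modulus g) :
    D.modulus 1 = 1 := by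
  have h := hmod 1 1
  rw [one_mul] at h
  have h1 : 0 < D.modulus 1 := D.modulus_pos one_ne_zero
  -- `m = m·m`, `m > 0` ⇒ `m = 1`
  have : D.modulus 1 * (D.modulus 1 - 1) = 0 := by rw [mul_sub, mul_one, ← h, sub_self]
  rcases mul_eq_zero.mp this with h0 | h0
  · exact absurd h0 h1.ne'
  · linarith

/-- (4) over a place datum with multiplicative modulus: `1` is recovered. [claim: Mochizuki2012, status: disputed] -/
theorem remark392_nonnegAt_units_one_mem (hT : Nonempty D.Adm)
    (hmod : ∀ f g : F, D.modulus (f * g) = D.modulus f * D.modulus g) :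
    (1 : Fˣ) ∈ Remark392_nonnegAt (fun (f : Fˣ) (S : Set D.X) => D.act (f : F) S) D.logVol := by
  rw [D.remark392_nonnegAt_units_eq hT, Set.mem_setOf_eq, Units.val_one, D.modulus_one_of_mul hmod]

/-- (4) over a place datum with multiplicative modulus: the recovered set is closed under multiplication — the
«submonoid of nonnegative elements». [claim: Mochizuki2012, status: disputed] -/
theorem remark392_nonnegAt_units_mul_mem (hT : Nonempty D.Adm)
    (hmod : ∀ f g : F, D.modulus (f * g) = D.modulus f * D.modulus g) {f g : Fˣ}
    (hf : f ∈ Remark392_nonnegAt (fun (f : Fˣ) (S : Set D.X) => D.act (f : F) S) D.logVol)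
    (hg : g ∈ Remark392_nonnegAt (fun (f : Fˣ) (S : Set D.X) => D.act (f : F) S) D.logVol) :
    f * g ∈ Remark392_nonnegAt (fun (f : Fˣ) (S : Set D.X) => D.act (f : F) S) D.logVol := by
  rw [D.remark392_nonnegAt_units_eq hT, Set.mem_setOf_eq] at hf hg ⊢
  rw [Units.val_mul, hmod]
  exact mul_le_one₀ hf (D.modulus_pos g.ne_zero).le hg

/-- The invertible elements of the recovered submonoid are exactly `{‖f‖ = 1}`: `f` and `f⁻¹` are both
«nonnegative» iff `‖f‖ = 1` — so the "subquotient associated to `w`" of the printed sentence (value group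
`F^×/{‖·‖_w = 1}`) is recovered together with its nonnegative part. [claim: Mochizuki2012, status: disputed] -/
theorem mem_and_inv_mem_remark392_nonnegAt_iff (hT : Nonempty D.Adm)
    (hmod : ∀ f g : F, D.modulus (f * g) = D.modulus f * D.modulus g) (f : Fˣ) :
    (f ∈ Remark392_nonnegAt (fun (f : Fˣ) (S : Set D.X) => D.act (f : F) S) D.logVol ∧
      f⁻¹ ∈ Remark392_nonnegAt (fun (f : Fˣ) (S : Set D.X) => D.act (f : F) S) D.logVol) ↔
      D.modulus (f : F) = 1 := by
  rw [D.remark392_nonnegAt_units_eq hT, Set.mem_setOf_eq, Set.mem_setOf_eq]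
  have hinv : D.modulus ((f⁻¹ : Fˣ) : F) * D.modulus (f : F) = 1 := by
    rw [← hmod, Units.val_inv_eq_inv_val, inv_mul_cancel₀ f.ne_zero, D.modulus_one_of_mul hmod]
  have hpos : 0 < D.modulus (f : F) := D.modulus_pos f.ne_zero
  have hpos' : 0 < D.modulus ((f⁻¹ : Fˣ) : F) := D.modulus_pos (f⁻¹).ne_zero
  constructor
  · rintro ⟨h1, h2⟩
    refine le_antisymm h1 ?_
    -- `‖f⁻¹‖ ≤ 1` and `‖f⁻¹‖·‖f‖ = 1` ⇒ `‖f‖ ≥ 1`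
    by_contra hlt
    have : D.modulus ((f⁻¹ : Fˣ) : F) * D.modulus (f : F) < 1 := by
      calc D.modulus ((f⁻¹ : Fˣ) : F) * D.modulus (f : F)
          ≤ 1 * D.modulus (f : F) := by gcongr
        _ < 1 := by rw [one_mul]; exact not_le.mp hlt
    exact absurd hinv this.ne
  · intro h
    refine ⟨h.le, ?_⟩
    rw [h, mul_one] at hinv
    exact hinv.le

end PlaceHaarDatum

/-! ### (2) The absolute genuine model: `{0 ≤ ord_v}` at finite `v`, `{|f|_w ≤ 1}` at archimedean `w` -/

section Absolute

variable (F : Type) [Field F] [NumberField F]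

/-- Every summand of the genuine model carries an admissible region (the unit ball `𝒪_v` resp. `𝒪_ℂ`, of volume
`1`: abc-iut-L6-d3's `idealRegionAt` of the unit family). [claim: Mochizuki2012, status: disputed] -/
theorem nonempty_adm_placeDatum (v : Place F) : Nonempty (placeDatum F v).Adm :=
  ⟨idealRegionAt F IdealFamily.unit v⟩

/-- The modulus of the genuine model is multiplicative (`|·|_w` resp. `‖·‖_v` are absolute values).
[claim: Mochizuki2012, status: disputed] -/
theorem placeDatum_modulus_mul (v : Place F) (f g : F) :
    (placeDatum F v).modulus (f * g) = (placeDatum F v).modulus f * (placeDatum F v).modulus g := by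
  rcases v with w | v
  · simp only [placeDatum_inl, archDatum_modulus, map_mul]
  · simp only [placeDatum_inr, nonarchDatum_modulus, map_mul]

/-- **[IUTchIII] Remark 3.9.2 at the genuine model of `F` (all places)**: the recovered set is `{f ∈ F^× | ‖f‖_v ≤ 1}`.
[claim: Mochizuki2012, status: disputed] -/
theorem remark392_nonnegAt_placeDatum (v : Place F) :
    Remark392_nonnegAt (fun (f : Fˣ) (S : Set (placeDatum F v).X) => (placeDatum F v).act (f : F) S)
        (placeDatum F v).logVol = {f : Fˣ | (placeDatum F v).modulus (f : F) ≤ 1} :=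
  (placeDatum F v).remark392_nonnegAt_units_eq (nonempty_adm_placeDatum F v)

/-- `‖f‖_v ≤ 1 ⟺ 0 ≤ ord_v(f)` for `f ∈ F^×` (campaign-S `log‖f‖_v = −ord_v(f)·log q_v`, `log q_v > 0`).
[cite: DupuyHilado2025, §2.5.5] -/
theorem adicAbv_le_one_iff_ord_nonneg (v : HeightOneSpectrum (𝓞 F)) {f : F} (hf : f ≠ 0) :
    NumberField.HeightOneSpectrum.adicAbv F v f ≤ 1 ↔ 0 ≤ ord F v f := by
  have hpos : 0 < NumberField.HeightOneSpectrum.adicAbv F v f :=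
    (NumberField.HeightOneSpectrum.adicAbv F v).pos hf
  rw [← Real.log_nonpos_iff hpos.le, log_adicAbv_eq_neg_deg F v hf, FinDivisor.deg_of, neg_nonpos,
    mul_nonneg_iff_of_pos_right (logNorm_pos F v)]
  exact Int.cast_nonneg_iff

/-- **[IUTchIII] Remark 3.9.2 at a FINITE place of the genuine model: the recovered «nonnegative elements» are
exactly `{f ∈ F^× | 0 ≤ ord_v(f)}`** — the nonnegative part of the value group at `v`, as printed.
[claim: Mochizuki2012, status: disputed] -/
theorem remark392_nonnegAt_placeDatum_inr (v : HeightOneSpectrum (𝓞 F)) :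
    Remark392_nonnegAt (fun (f : Fˣ) (S : Set (placeDatum F (Sum.inr v)).X) =>
        (placeDatum F (Sum.inr v)).act (f : F) S) (placeDatum F (Sum.inr v)).logVol =
      {f : Fˣ | 0 ≤ ord F v (f : F)} := by
  rw [remark392_nonnegAt_placeDatum]
  ext f
  simp only [Set.mem_setOf_eq, placeDatum_inr, nonarchDatum_modulus]
  exact adicAbv_le_one_iff_ord_nonneg F v f.ne_zero

/-- [IUTchIII] Remark 3.9.2 at an ARCHIMEDEAN place of the genuine model: the recovered set is `{f ∈ F^× | |f|_w ≤ 1}`.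
[claim: Mochizuki2012, status: disputed] -/
theorem remark392_nonnegAt_placeDatum_inl (w : InfinitePlace F) :
    Remark392_nonnegAt (fun (f : Fˣ) (S : Set (placeDatum F (Sum.inl w)).X) =>
        (placeDatum F (Sum.inl w)).act (f : F) S) (placeDatum F (Sum.inl w)).logVol =
      {f : Fˣ | w (f : F) ≤ 1} := by
  rw [remark392_nonnegAt_placeDatum]
  rfl

/-- (4) at the genuine model: `1` is recovered and the recovered set is closed under multiplication (a submonoid
of `F^×`). [claim: Mochizuki2012, status: disputed] -/
theorem remark392_nonnegAt_placeDatum_mul_mem (v : Place F) {f g : Fˣ}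
    (hf : f ∈ Remark392_nonnegAt (fun (f : Fˣ) (S : Set (placeDatum F v).X) => (placeDatum F v).act (f : F) S)
      (placeDatum F v).logVol)
    (hg : g ∈ Remark392_nonnegAt (fun (f : Fˣ) (S : Set (placeDatum F v).X) => (placeDatum F v).act (f : F) S)
      (placeDatum F v).logVol) :
    (1 : Fˣ) ∈ Remark392_nonnegAt (fun (f : Fˣ) (S : Set (placeDatum F v).X) => (placeDatum F v).act (f : F) S)
        (placeDatum F v).logVol ∧
      f * g ∈ Remark392_nonnegAt (fun (f : Fˣ) (S : Set (placeDatum F v).X) => (placeDatum F v).act (f : F) S)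
        (placeDatum F v).logVol :=
  ⟨(placeDatum F v).remark392_nonnegAt_units_one_mem (nonempty_adm_placeDatum F v) (placeDatum_modulus_mul F v),
    (placeDatum F v).remark392_nonnegAt_units_mul_mem (nonempty_adm_placeDatum F v) (placeDatum_modulus_mul F v)
      hf hg⟩

/-- The invertible part of the recovered submonoid at a finite place: `f` and `f⁻¹` are both «nonnegative» iff
`ord_v(f) = 0` — the kernel of `F^× ↠ ℤ = ` (value group at `v`), i.e. the "subquotient associated to `w`" is
recovered too. [claim: Mochizuki2012, status: disputed] -/
theorem remark392_nonnegAt_placeDatum_inr_units_iff (v : HeightOneSpectrum (𝓞 F)) (f : Fˣ) :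
    (f ∈ Remark392_nonnegAt (fun (f : Fˣ) (S : Set (placeDatum F (Sum.inr v)).X) =>
        (placeDatum F (Sum.inr v)).act (f : F) S) (placeDatum F (Sum.inr v)).logVol ∧
      f⁻¹ ∈ Remark392_nonnegAt (fun (f : Fˣ) (S : Set (placeDatum F (Sum.inr v)).X) =>
        (placeDatum F (Sum.inr v)).act (f : F) S) (placeDatum F (Sum.inr v)).logVol) ↔
      ord F v (f : F) = 0 := by
  rw [remark392_nonnegAt_placeDatum_inr, Set.mem_setOf_eq, Set.mem_setOf_eq, Units.val_inv_eq_inv_val, ord_inv]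
  omega

end Absolute

/-! ### (3) VERBATIM AT `𝕍̲`: the relative summands `K_w` recover the nonnegative submonoid of `F_mod` at `w|_{F_mod}` -/

section Relative

variable (F K : Type) [Field F] [NumberField F] [Field K] [NumberField K] [Algebra F K]

omit [NumberField F] in
/-- Every relative summand `K_w` carries an admissible region (pull-back keeps summand and volume).
[claim: Mochizuki2012, status: disputed] -/
theorem nonempty_adm_relPlaceDatum (w : Place K) : Nonempty (relPlaceDatum F K w).Adm :=
  ⟨idealRegionAt K IdealFamily.unit w⟩

omit [NumberField F] in
/-- The relative modulus `f ↦ ‖f‖_{K_w}` is multiplicative. [claim: Mochizuki2012, status: disputed] -/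
theorem relPlaceDatum_modulus_mul (w : Place K) (f g : F) :
    (relPlaceDatum F K w).modulus (f * g) = (relPlaceDatum F K w).modulus f * (relPlaceDatum F K w).modulus g := by
  show (placeDatum K w).modulus (algebraMap F K (f * g)) = _
  rw [map_mul, placeDatum_modulus_mul]
  rfl

omit [NumberField F] in
/-- [IUTchIII] Remark 3.9.2 on the relative summand `K_w` (generic form): the recovered set is `{f ∈ F^× | ‖f‖_{K_w} ≤ 1}`.
[claim: Mochizuki2012, status: disputed] -/
theorem remark392_nonnegAt_relPlaceDatum (w : Place K) :
    Remark392_nonnegAt (fun (f : Fˣ) (S : Set (relPlaceDatum F K w).X) => (relPlaceDatum F K w).act (f : F) S)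
        (relPlaceDatum F K w).logVol = {f : Fˣ | (relPlaceDatum F K w).modulus (f : F) ≤ 1} :=
  (relPlaceDatum F K w).remark392_nonnegAt_units_eq (nonempty_adm_relPlaceDatum F K w)

/-- `‖f‖_{K_w} ≤ 1 ⟺ ‖f‖_{F_v} ≤ 1` for `f ∈ F^×`, `v = w|_F`: at a finite `w` from abc-iut-L6-t5's
`log‖f‖_{K_w} = [K_w:F_v]·log‖f‖_v` with `[K_w:F_v] > 0`; at an archimedean `w` from abc-iut-w5-d030's `|f|_w = |f|_v`.
[claim: Mochizuki2012, status: disputed] -/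
theorem relPlaceDatum_modulus_le_one_iff (w : Place K) {f : F} (hf : f ≠ 0) :
    (relPlaceDatum F K w).modulus f ≤ 1 ↔ (placeDatum F (Place.below F K w)).modulus f ≤ 1 := by
  rcases w with w | w
  · rw [modulus_relPlaceDatum_inl]
    rfl
  · have hposK : 0 < (relPlaceDatum F K (Sum.inr w)).modulus f := (relPlaceDatum F K (Sum.inr w)).modulus_pos hf
    have hposF : 0 < (placeDatum F (Sum.inr (finBelow F K w))).modulus f :=
      (placeDatum F (Sum.inr (finBelow F K w))).modulus_pos hf
    have hd : (0 : ℝ) < relLocalDegree F K (Sum.inr w) := by exact_mod_cast relLocalDegree_pos F K (Sum.inr w)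
    show _ ↔ (placeDatum F (Sum.inr (finBelow F K w))).modulus f ≤ 1
    rw [← Real.log_nonpos_iff hposK.le, ← Real.log_nonpos_iff hposF.le, log_modulus_relPlaceDatum_inr F K w hf]
    constructor
    · intro h
      by_contra hlt
      exact absurd h (not_le.mpr (mul_pos hd (not_le.mp hlt)))
    · intro h
      have := mul_le_mul_of_nonneg_left h hd.le
      rwa [mul_zero] at this

/-- **[IUTchIII] Remark 3.9.2 VERBATIM AT `𝕍̲`.** For every place `w` of `K ⊋ F_mod`, "considering the effect of
multiplication by elements of `(†𝕄⊛_mod)_α`" (here `F_mod^× = F^×`) on the log-volumes of the summand `K_w`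
recovers EXACTLY the set recovered by the absolute model of `F_mod` at the place `v = w|_{F_mod}` below — the
subquotient "associated to `w ∈ 𝕍̲`" with its nonnegative submonoid depends only on `w|_{F_mod}`.
[claim: Mochizuki2012, status: disputed] -/
theorem remark392_nonnegAt_relPlaceDatum_eq_below (w : Place K) :
    Remark392_nonnegAt (fun (f : Fˣ) (S : Set (relPlaceDatum F K w).X) => (relPlaceDatum F K w).act (f : F) S)
        (relPlaceDatum F K w).logVol =
      Remark392_nonnegAt (fun (f : Fˣ) (S : Set (placeDatum F (Place.below F K w)).X) =>
        (placeDatum F (Place.below F K w)).act (f : F) S) (placeDatum F (Place.below F K w)).logVol := by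
  rw [remark392_nonnegAt_relPlaceDatum, remark392_nonnegAt_placeDatum]
  ext f
  exact relPlaceDatum_modulus_le_one_iff F K w f.ne_zero

/-- **[IUTchIII] Remark 3.9.2 at a FINITE `w ∈ 𝕍̲`: the «submonoid of nonnegative elements» of the subquotient of
`(†𝕄⊛_mod)_α` at `w` is `{f ∈ F_mod^× | 0 ≤ ord_v(f)}`, `v = w|_{F_mod}`** — recovered from the `w`-summand `K_w`.
[claim: Mochizuki2012, status: disputed] -/
theorem remark392_nonnegAt_relPlaceDatum_inr (w : HeightOneSpectrum (𝓞 K)) :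
    Remark392_nonnegAt (fun (f : Fˣ) (S : Set (relPlaceDatum F K (Sum.inr w)).X) =>
        (relPlaceDatum F K (Sum.inr w)).act (f : F) S) (relPlaceDatum F K (Sum.inr w)).logVol =
      {f : Fˣ | 0 ≤ ord F (finBelow F K w) (f : F)} := by
  rw [remark392_nonnegAt_relPlaceDatum_eq_below]
  exact remark392_nonnegAt_placeDatum_inr F (finBelow F K w)

/-- [IUTchIII] Remark 3.9.2 at an ARCHIMEDEAN `w ∈ 𝕍̲`: the recovered set is `{f ∈ F_mod^× | |f|_v ≤ 1}`, `v = w|_{F_mod}`.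
[claim: Mochizuki2012, status: disputed] -/
theorem remark392_nonnegAt_relPlaceDatum_inl (w : InfinitePlace K) :
    Remark392_nonnegAt (fun (f : Fˣ) (S : Set (relPlaceDatum F K (Sum.inl w)).X) =>
        (relPlaceDatum F K (Sum.inl w)).act (f : F) S) (relPlaceDatum F K (Sum.inl w)).logVol =
      {f : Fˣ | (w.comap (algebraMap F K)) (f : F) ≤ 1} := by
  rw [remark392_nonnegAt_relPlaceDatum_eq_below]
  exact remark392_nonnegAt_placeDatum_inl F (w.comap (algebraMap F K))

omit [NumberField F] in
/-- (4) on the relative summands: `1` is recovered and the recovered set is closed under multiplication.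
[claim: Mochizuki2012, status: disputed] -/
theorem remark392_nonnegAt_relPlaceDatum_mul_mem (w : Place K) {f g : Fˣ}
    (hf : f ∈ Remark392_nonnegAt (fun (f : Fˣ) (S : Set (relPlaceDatum F K w).X) =>
      (relPlaceDatum F K w).act (f : F) S) (relPlaceDatum F K w).logVol)
    (hg : g ∈ Remark392_nonnegAt (fun (f : Fˣ) (S : Set (relPlaceDatum F K w).X) =>
      (relPlaceDatum F K w).act (f : F) S) (relPlaceDatum F K w).logVol) :
    (1 : Fˣ) ∈ Remark392_nonnegAt (fun (f : Fˣ) (S : Set (relPlaceDatum F K w).X) =>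
        (relPlaceDatum F K w).act (f : F) S) (relPlaceDatum F K w).logVol ∧
      f * g ∈ Remark392_nonnegAt (fun (f : Fˣ) (S : Set (relPlaceDatum F K w).X) =>
        (relPlaceDatum F K w).act (f : F) S) (relPlaceDatum F K w).logVol :=
  ⟨(relPlaceDatum F K w).remark392_nonnegAt_units_one_mem (nonempty_adm_relPlaceDatum F K w)
      (relPlaceDatum_modulus_mul F K w),
    (relPlaceDatum F K w).remark392_nonnegAt_units_mul_mem (nonempty_adm_relPlaceDatum F K w)
      (relPlaceDatum_modulus_mul F K w) hf hg⟩

/-- The invertible part at a finite `w ∈ 𝕍̲`: `f, f⁻¹ ∈ F_mod^×` both recovered iff `ord_v(f) = 0`, `v = w|_{F_mod}`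
(the subquotient at `w` IS the value group of `F_mod` at the place below). [claim: Mochizuki2012, status: disputed] -/
theorem remark392_nonnegAt_relPlaceDatum_inr_units_iff (w : HeightOneSpectrum (𝓞 K)) (f : Fˣ) :
    (f ∈ Remark392_nonnegAt (fun (f : Fˣ) (S : Set (relPlaceDatum F K (Sum.inr w)).X) =>
        (relPlaceDatum F K (Sum.inr w)).act (f : F) S) (relPlaceDatum F K (Sum.inr w)).logVol ∧
      f⁻¹ ∈ Remark392_nonnegAt (fun (f : Fˣ) (S : Set (relPlaceDatum F K (Sum.inr w)).X) =>
        (relPlaceDatum F K (Sum.inr w)).act (f : F) S) (relPlaceDatum F K (Sum.inr w)).logVol) ↔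
      ord F (finBelow F K w) (f : F) = 0 := by
  rw [remark392_nonnegAt_relPlaceDatum_inr, Set.mem_setOf_eq, Set.mem_setOf_eq, Units.val_inv_eq_inv_val, ord_inv]
  omega

end Relative

end Literature.IUT.LogThetaLattice

end
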